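import Literature.Analysis.FluidPDE.GalerkinSmoothHm
import HarnessLib

/-!
# Smooth short-time solutions by the Fourier–Galerkin energy method, II: the Galerkin
# approximations are Cauchy in `C([0,T]; L²)`

Analysis/FluidPDE proof file (theorems only), sequel of `GalerkinSmoothHm.lean`. For the damped
Galerkin systems `β' = V(-σβ, β)` on the frequency balls `freqBall n ⊆ freqBall n'` (viscosity
`ν ≥ 0`, nonnegative damping symbol `σ`; Euler, Navier–Stokes, fractional Navier–Stokes), the
difference of two solutions is estimated in `ℓ² = L²` exactly as in A. J. Majda, A. L. Bertozzi,
*Vorticity and Incompressible Flow*, CUP 2002, proof of Thm. 3.4, (3.61)–(3.64) ("the family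
`(v^ε)` forms a Cauchy sequence in `C([0,T]; L²(ℝ³))`"): with `δu = u' - u`,
`d/dt ½‖δu‖² + (dissipation ≥ 0) = -∫⟪δu, (δu·∇)u'⟫ - ∫⟪(1 - P_n)u', (u·∇)u⟫`, the first term
being `≤ ‖∇u'‖_∞ ‖δu‖²` and the second `≤ ‖(1-P_n)u'‖_{L²} ‖u‖_∞ ‖∇u‖_{L²} = O((1+n²)^{-s/2})` by
the uniform `H^s` bounds of part I; Grönwall then gives `sup_{[0,T]} ‖δu‖² = O((1+n²)^{-s/2})`.

## Contents (all proved)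

* `re_inner_galerkinField_of_transversal` — per-mode pairing with the Galerkin field;
* `sum_re_inner_fieldDiff_le` — the linear (Stokes + damping) part of the pairing of
  `δ = ā - b̄` with the difference of the two fields is `≤ 0`;
* `convectionPairing_diff_le` — the nonlinear part in physical space:
  `-(∫⟪δu,(u'·∇)u'⟫ - ∫⟪P_Sδu,(u·∇)u⟫) ≤ |∫⟪(δu·∇)u', δu⟫| + |∫⟪(u·∇)u, δu - P_Sδu⟫|`
  (`(u'·∇)u' - (u·∇)u = (u·∇)δu + (δu·∇)u'`, `∫⟪δu,(u·∇)δu⟫ = 0`);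
* `abs_transportTerm_le`, `abs_defectTerm_le`, `integral_norm_sq_defect`, `tail_le` — the
  quantitative bounds (`H² ⊂ L^∞` of part I, Parseval, `(1+n²)ˢ ≤ (1+|k|²)ˢ` off `freqBall n`);
* `cauchyPairing_le` — the differential inequality at a fixed time;
* `galerkin_cauchy_estimate` — **the Cauchy estimate**: `E(t) = ∑_k ‖β'(t)_k - β̄(t)_k‖² ≤
  gronwallBound E(0) K ε t`, `K = 2#d√B(2π)√R`, `ε = 2√B√R·#d(2π)√R·√((1+n²)^{-s}R_s)`, given
  `W₃(β̄') ≤ R`, `W₂(β̄) ≤ R`, `W_s(β̄') ≤ R_s` on `[0,T]` (supplied, uniformly in `n, n'`, by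
  `GalerkinSmooth.sobolev_bounds_allOrders`).

## References

* A. J. Majda, A. L. Bertozzi, *Vorticity and Incompressible Flow*, CUP 2002, §3.2.2, proof of
  Thm. 3.4, (3.61)–(3.64). [`MajdaBertozziCUP2002`]
* J. C. Robinson, J. L. Rodrigo, W. Sadowski, *The three-dimensional Navier–Stokes equations*,
  CUP 2016, §4.1 (the Fourier–Galerkin scheme on the torus). [`RobinsonRodrigoSadowski2016`]
-/

noncomputable section

open MeasureTheory Set Filter Topology Function UnitAddTorus Metric
open scoped ENNReal NNReal InnerProductSpace ContDiff

namespace Literature.Analysis.FluidPDE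

namespace GalerkinSmooth

open FunctionSpaces FunctionSpaces.Torus Torus EulerGalerkin

variable {d : Type*} [Fintype d] [DecidableEq d]

/-! ## Elementary lemmas -/

section Elementary

variable {F : Type*} [NormedAddCommGroup F] [NormedSpace ℝ F]

omit [Fintype d] [DecidableEq d] in
/-- The convective derivative is additive in the transporting field. [folklore] -/
theorem convect_add_left' (u₁ u₂ : UnitAddTorus d → EuclideanSpace ℝ d) (v : UnitAddTorus d → F)
    (x : UnitAddTorus d) :
    Torus.convect (fun y => u₁ y + u₂ y) v x = Torus.convect u₁ v x + Torus.convect u₂ v x := by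
  simp [FunctionSpaces.Torus.convect]

omit [DecidableEq d] in
/-- The convective derivative is additive in the transported field (`C¹`). [folklore] -/
theorem convect_add_right' (u : UnitAddTorus d → EuclideanSpace ℝ d) {v w : UnitAddTorus d → F}
    (hv : IsContDiff 1 v) (hw : IsContDiff 1 w) (x : UnitAddTorus d) :
    Torus.convect u (fun y => v y + w y) x = Torus.convect u v x + Torus.convect u w x := by
  simp only [FunctionSpaces.Torus.convect]
  rw [show (fun y => v y + w y) = v + w from rfl, FunctionSpaces.Torus.fderiv_add hv hw]
  rfl

omit [DecidableEq d] in
/-- **Per-mode pairing with the Galerkin field** against a vector `x` transversal at `k`: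
`Re⟪x, V(g,c)_k⟫ = -ν4π²|k|² Re⟪x, c k⟫ + Re⟪x, g k⟫ - Re⟪x, 𝓕[(u·∇)u](k)⟫` (the Leray
multiplier drops out, `inner_leraySym_right_of_transversal`). [folklore] -/
theorem re_inner_galerkinField_of_transversal (ν : ℝ) (S : Finset (d → ℤ))
    (g c : (d → ℤ) → EuclideanSpace ℂ d) {x : EuclideanSpace ℂ d} {k : d → ℤ}
    (hx : ∑ i, (k i : ℂ) * x i = 0) :
    (inner ℂ x (galerkinField ν S g c k)).re =
      -(ν * (4 * Real.pi ^ 2 * freqNormSq k)) * (inner ℂ x (c k)).re + (inner ℂ x (g k)).re -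
        (inner ℂ x (convectionCoeff S c c k)).re := by
  rw [galerkinField, inner_add_right, Complex.add_re, inner_leraySym_right_of_transversal _ _ hx,
    inner_sub_right, Complex.sub_re, inner_neg_right, Complex.neg_re, inner_smul_right,
    Complex.re_ofReal_mul]
  ring

omit [DecidableEq d] in
/-- Extension by zero of the damping force: `coeffExt S (-σ • c) = -σ • coeffExt S c`. [folklore] -/
theorem coeffExt_dampForce {S : Finset (d → ℤ)} (σ : (d → ℤ) → ℝ) (c : ↥S → EuclideanSpace ℂ d) :
    coeffExt S (fun k : ↥S => -((((σ (k : d → ℤ)) : ℝ) : ℂ) • c k)) =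
      fun k => -((((σ k) : ℝ) : ℂ) • coeffExt S c k) := by
  funext k
  by_cases hk : k ∈ S
  · rw [coeffExt_of_mem _ hk, coeffExt_of_mem _ hk]
  · rw [coeffExt_of_not_mem _ hk, coeffExt_of_not_mem _ hk, smul_zero, neg_zero]

omit [DecidableEq d] in
/-- A transversal family extended by zero is transversal on every frequency set. [folklore] -/
theorem isTransversal_coeffExt_of_subset {S S' : Finset (d → ℤ)} {c : ↥S → EuclideanSpace ℂ d}
    (hc : IsSolenoidalCoeff c) : IsTransversal S' (coeffExt S c) := by
  intro k _
  by_cases hk : k ∈ S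
  · exact hc.isTransversal_coeffExt k hk
  · simp [coeffExt_of_not_mem c hk]

omit [DecidableEq d] in
/-- A real trigonometric polynomial on `S ⊆ S'` is one on `S'` (the coefficients vanish on
`S' \\ S`). [folklore] -/
theorem realTrigPoly_coeffExt_of_subset {S S' : Finset (d → ℤ)} (hSS' : S ⊆ S')
    (c : ↥S → EuclideanSpace ℂ d) :
    realTrigPoly S' (coeffExt S c) = realTrigPoly S (coeffExt S c) := by
  rw [realTrigPoly_eq_comp, realTrigPoly_eq_comp, trigPoly_subset hSS']
  exact fun k _ hk => coeffExt_of_not_mem c hk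

omit [DecidableEq d] in
/-- Truncation to `S ⊆ S'` of a polynomial on `S'`: `realTrigPoly S c = realTrigPoly S' (1_S c)`. [folklore] -/
theorem realTrigPoly_eq_realTrigPoly_indicator {S S' : Finset (d → ℤ)} (hSS' : S ⊆ S')
    (c : (d → ℤ) → EuclideanSpace ℂ d) :
    realTrigPoly S c = realTrigPoly S' (fun k => if k ∈ S then c k else 0) := by
  rw [realTrigPoly_eq_comp, realTrigPoly_eq_comp, trigPoly_subset hSS' (c := fun k => if k ∈ S then c k else 0)
    (fun k _ hk => if_neg hk)]
  congr 1
  exact trigPoly_congr fun k hk => by rw [if_pos hk]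

end Elementary


/-! ## The Cauchy pairing at a fixed time -/

section CauchyPairing

variable {S S' : Finset (d → ℤ)}

omit [DecidableEq d] in
/-- **The linear part of the Cauchy pairing.** For `S ⊆ S'`, states `a` on `S'` and `b` on `S`
(real, divergence free), `δ = ā - b̄`, viscosity `ν ≥ 0` and damping `σ ≥ 0`:
`∑_{k∈S'} Re⟪δ k, V_{S'}(-σā, ā)_k - 1_S(k) V_S(-σb̄, b̄)_k⟫
  ≤ -(∑_{k∈S'} Re⟪δ k, 𝓕_{S'}[(u'·∇)u'](k)⟫ - ∑_{k∈S} Re⟪δ k, 𝓕_S[(u·∇)u](k)⟫)`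
(the Stokes and damping terms combine into `-∑(ν4π²|k|² + σ_k)‖δ k‖² ≤ 0`). [folklore] -/
theorem sum_re_inner_fieldDiff_le (hSS' : S ⊆ S') {ν : ℝ} (hν : 0 ≤ ν) {σ : (d → ℤ) → ℝ}
    (hσ : ∀ k, 0 ≤ σ k) {a : ↥S' → EuclideanSpace ℂ d} (ha : a ∈ galerkinSubspace S')
    {b : ↥S → EuclideanSpace ℂ d} (hb : b ∈ galerkinSubspace S) :
    ∑ k ∈ S', (inner ℂ (coeffExt S' a k - coeffExt S b k)
        (galerkinField ν S' (fun k => -((((σ k) : ℝ) : ℂ) • coeffExt S' a k)) (coeffExt S' a) k -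
          coeffExt S (galerkinRHS S ν (fun k : ↥S => -((((σ (k : d → ℤ)) : ℝ) : ℂ) • b k)) b) k)).re ≤
      -(∑ k ∈ S', (inner ℂ (coeffExt S' a k - coeffExt S b k)
          (convectionCoeff S' (coeffExt S' a) (coeffExt S' a) k)).re -
        ∑ k ∈ S, (inner ℂ (coeffExt S' a k - coeffExt S b k)
          (convectionCoeff S (coeffExt S b) (coeffExt S b) k)).re) := by
  set A := coeffExt S' a with hA
  set Bc := coeffExt S b with hBc
  have hδT : ∀ k, ∑ i, (k i : ℂ) * (A k - Bc k) i = 0 := by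
    intro k
    have hA' : ∑ i, (k i : ℂ) * A k i = 0 := by
      by_cases hk : k ∈ S'
      · exact ha.2.isTransversal_coeffExt k hk
      · simp [hA, coeffExt_of_not_mem a hk]
    have hB' : ∑ i, (k i : ℂ) * Bc k i = 0 := by
      by_cases hk : k ∈ S
      · exact hb.2.isTransversal_coeffExt k hk
      · simp [hBc, coeffExt_of_not_mem b hk]
    simp only [PiLp.sub_apply, mul_sub, Finset.sum_sub_distrib, hA', hB', sub_zero]
  -- per-mode expansion of the two fields
  have h1 : ∀ k ∈ S', (inner ℂ (A k - Bc k)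
      (galerkinField ν S' (fun k => -((((σ k) : ℝ) : ℂ) • A k)) A k)).re =
      -(ν * (4 * Real.pi ^ 2 * freqNormSq k)) * (inner ℂ (A k - Bc k) (A k)).re +
        -(σ k * (inner ℂ (A k - Bc k) (A k)).re) -
        (inner ℂ (A k - Bc k) (convectionCoeff S' A A k)).re := by
    intro k _
    rw [re_inner_galerkinField_of_transversal ν S' _ A (hδT k), inner_neg_right, Complex.neg_re,
      inner_smul_right, Complex.re_ofReal_mul]
  have h2 : ∀ k ∈ S', (inner ℂ (A k - Bc k)
      (coeffExt S (galerkinRHS S ν (fun k : ↥S => -((((σ (k : d → ℤ)) : ℝ) : ℂ) • b k)) b) k)).re =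
      -(ν * (4 * Real.pi ^ 2 * freqNormSq k)) * (inner ℂ (A k - Bc k) (Bc k)).re +
        -(σ k * (inner ℂ (A k - Bc k) (Bc k)).re) -
        (if k ∈ S then (inner ℂ (A k - Bc k) (convectionCoeff S Bc Bc k)).re else 0) := by
    intro k _
    by_cases hk : k ∈ S
    · rw [if_pos hk, coeffExt_of_mem _ hk, galerkinRHS_apply, coeffExt_dampForce,
        re_inner_galerkinField_of_transversal ν S _ Bc (hδT k), inner_neg_right, Complex.neg_re,
        inner_smul_right, Complex.re_ofReal_mul]
    · rw [if_neg hk, coeffExt_of_not_mem _ hk]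
      have hB0 : Bc k = 0 := by rw [hBc, coeffExt_of_not_mem b hk]
      simp [hB0]
  have hsplit : ∀ k ∈ S', (inner ℂ (A k - Bc k)
      (galerkinField ν S' (fun k => -((((σ k) : ℝ) : ℂ) • A k)) A k -
        coeffExt S (galerkinRHS S ν (fun k : ↥S => -((((σ (k : d → ℤ)) : ℝ) : ℂ) • b k)) b) k)).re =
      -((ν * (4 * Real.pi ^ 2 * freqNormSq k) + σ k) * ‖A k - Bc k‖ ^ 2) -
        (inner ℂ (A k - Bc k) (convectionCoeff S' A A k)).re +
        (if k ∈ S then (inner ℂ (A k - Bc k) (convectionCoeff S Bc Bc k)).re else 0) := by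
    intro k hk
    rw [inner_sub_right, Complex.sub_re, h1 k hk, h2 k hk]
    have hn : (inner ℂ (A k - Bc k) (A k)).re - (inner ℂ (A k - Bc k) (Bc k)).re = ‖A k - Bc k‖ ^ 2 := by
      rw [← Complex.sub_re, ← inner_sub_right, ← real_inner_eq_re_inner_euclidean, real_inner_self_eq_norm_sq]
    rw [← hn]
    ring
  rw [Finset.sum_congr rfl hsplit, Finset.sum_add_distrib, Finset.sum_sub_distrib, Finset.sum_ite_mem,
    (Finset.inter_eq_right.2 hSS' : S' ∩ S = S)]
  have hneg : ∑ k ∈ S', -((ν * (4 * Real.pi ^ 2 * freqNormSq k) + σ k) * ‖A k - Bc k‖ ^ 2) ≤ 0 :=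
    Finset.sum_nonpos fun k _ => neg_nonpos.2 (mul_nonneg (add_nonneg
      (mul_nonneg hν (mul_nonneg (by positivity) (freqNormSq_nonneg k))) (hσ k)) (sq_nonneg _))
  linarith

/-- **The nonlinear part of the Cauchy pairing, in physical space.** With `u' = realTrigPoly S' ā`,
`u = realTrigPoly S b̄`, `δu = u' - u = realTrigPoly S' δ` and `P_S δu = realTrigPoly S δ`:
`-(∫⟪δu, (u'·∇)u'⟫ - ∫⟪P_Sδu, (u·∇)u⟫) ≤ |∫⟪(δu·∇)u', δu⟫| + |∫⟪(u·∇)u, δu - P_Sδu⟫|`, because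
`(u'·∇)u' - (u·∇)u = (u·∇)δu + (δu·∇)u'` and `∫⟪δu, (u·∇)δu⟫ = 0` (Majda–Bertozzi 2002, proof of
(3.61): the energy estimate for the difference of two regularised solutions). [cite: MajdaBertozziCUP2002, Thm. 3.4 proof, (3.61)–(3.62)] -/
theorem convectionPairing_diff_le (hS : ∀ k ∈ S, -k ∈ S) (hS' : ∀ k ∈ S', -k ∈ S') (hSS' : S ⊆ S')
    {a : ↥S' → EuclideanSpace ℂ d} (ha : a ∈ galerkinSubspace S')
    {b : ↥S → EuclideanSpace ℂ d} (hb : b ∈ galerkinSubspace S) :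
    -(∑ k ∈ S', (inner ℂ (coeffExt S' a k - coeffExt S b k)
          (convectionCoeff S' (coeffExt S' a) (coeffExt S' a) k)).re -
        ∑ k ∈ S, (inner ℂ (coeffExt S' a k - coeffExt S b k)
          (convectionCoeff S (coeffExt S b) (coeffExt S b) k)).re) ≤
      |∫ x, ⟪Torus.convect (realTrigPoly S' (coeffExt S' a - coeffExt S b)) (realTrigPoly S' (coeffExt S' a)) x,
          realTrigPoly S' (coeffExt S' a - coeffExt S b) x⟫_ℝ| +
      |∫ x, ⟪Torus.convect (realTrigPoly S (coeffExt S b)) (realTrigPoly S (coeffExt S b)) x,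
          realTrigPoly S' (coeffExt S' a - coeffExt S b) x - realTrigPoly S (coeffExt S' a - coeffExt S b) x⟫_ℝ| := by
  set A := coeffExt S' a with hA
  set Bc := coeffExt S b with hBc
  set δ := A - Bc with hδ
  have hAc : IsConjSymm A := ha.1.isConjSymm_coeffExt hS'
  have hBcc : IsConjSymm Bc := hb.1.isConjSymm_coeffExt hS
  have hδc : IsConjSymm δ := hAc.sub hBcc
  have hBT : IsTransversal S Bc := hb.2.isTransversal_coeffExt
  set u' := realTrigPoly S' A with hu'
  set u := realTrigPoly S Bc with hu
  set δu := realTrigPoly S' δ with hδu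
  set P := realTrigPoly S δ with hP
  have hu's : IsSmooth u' := isSmooth_realTrigPoly S' A
  have hus : IsSmooth u := isSmooth_realTrigPoly S Bc
  have hδus : IsSmooth δu := isSmooth_realTrigPoly S' δ
  have hPs : IsSmooth P := isSmooth_realTrigPoly S δ
  have hudiv : IsDivFree u := isDivFree_realTrigPoly hBT
  -- `u' = u + δu`
  have hu'eq : ∀ x, u' x = u x + δu x := by
    intro x
    have h1 : realTrigPoly S' Bc = u := by rw [hu, hBc]; exact realTrigPoly_coeffExt_of_subset hSS' b
    have h2 : A = Bc + δ := by rw [hδ]; abel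
    rw [hu', h2, realTrigPoly_add, ← h1]
    rfl
  -- the two sums as integrals
  have hX1 : ∑ k ∈ S', (inner ℂ (A k - Bc k) (convectionCoeff S' A A k)).re = ∫ x, ⟪δu x, Torus.convect u' u' x⟫_ℝ := by
    rw [hδu, integral_inner_realTrigPoly_left hS' hδc ((hu's.convect hu's).memLp 2)]
    refine Finset.sum_congr rfl fun k _ => ?_
    rw [hu', mFourierCoeff_convect_realTrigPoly hS' hAc hAc]
    rfl
  have hX2 : ∑ k ∈ S, (inner ℂ (A k - Bc k) (convectionCoeff S Bc Bc k)).re = ∫ x, ⟪P x, Torus.convect u u x⟫_ℝ := by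
    rw [hP, integral_inner_realTrigPoly_left hS hδc ((hus.convect hus).memLp 2)]
    refine Finset.sum_congr rfl fun k _ => ?_
    rw [hu, mFourierCoeff_convect_realTrigPoly hS hBcc hBcc]
    rfl
  rw [hX1, hX2]
  -- pointwise algebra of the convective terms
  have hconv : ∀ x, Torus.convect u' u' x = Torus.convect u u x +
      (Torus.convect u δu x + Torus.convect δu u' x) := by
    intro x
    have h1 : Torus.convect u' u' x = Torus.convect (fun y => u y + δu y) u' x := by
      congr 1; funext y; exact hu'eq y
    have h2 : Torus.convect u u' x = Torus.convect u (fun y => u y + δu y) x := by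
      congr 1; funext y; exact hu'eq y
    rw [h1, convect_add_left', h2, convect_add_right' u (hus.isContDiff (by simp)) (hδus.isContDiff (by simp))]
    abel
  have hi1 : Integrable (fun x => ⟪δu x, Torus.convect u u x⟫_ℝ) volume := (hδus.inner (hus.convect hus)).integrable
  have hi2 : Integrable (fun x => ⟪δu x, Torus.convect u δu x⟫_ℝ) volume := (hδus.inner (hus.convect hδus)).integrable
  have hi3 : Integrable (fun x => ⟪δu x, Torus.convect δu u' x⟫_ℝ) volume := (hδus.inner (hδus.convect hu's)).integrable
  have hiP : Integrable (fun x => ⟪P x, Torus.convect u u x⟫_ℝ) volume := (hPs.inner (hus.convect hus)).integrable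
  have hsplit : (∫ x, ⟪δu x, Torus.convect u' u' x⟫_ℝ) =
      (∫ x, ⟪δu x, Torus.convect u u x⟫_ℝ) + ((∫ x, ⟪δu x, Torus.convect u δu x⟫_ℝ) +
        ∫ x, ⟪δu x, Torus.convect δu u' x⟫_ℝ) := by
    have hi23 : Integrable (fun x => ⟪δu x, Torus.convect u δu x⟫_ℝ + ⟪δu x, Torus.convect δu u' x⟫_ℝ) volume :=
      hi2.add hi3
    rw [← integral_add hi2 hi3, ← integral_add hi1 hi23]
    refine integral_congr_ae (ae_of_all _ fun x => ?_)
    show ⟪δu x, Torus.convect u' u' x⟫_ℝ =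
      ⟪δu x, Torus.convect u u x⟫_ℝ + (⟪δu x, Torus.convect u δu x⟫_ℝ + ⟪δu x, Torus.convect δu u' x⟫_ℝ)
    rw [hconv x, inner_add_right, inner_add_right]
  -- the cancellation `∫⟪δu, (u·∇)δu⟫ = 0`
  have hcancel : (∫ x, ⟪δu x, Torus.convect u δu x⟫_ℝ) = 0 := by
    have h := integral_inner_convect_eq_neg hus hudiv hδus hδus
    have hsym : (∫ x, ⟪Torus.convect u δu x, δu x⟫_ℝ) = ∫ x, ⟪δu x, Torus.convect u δu x⟫_ℝ :=
      integral_congr_ae (ae_of_all _ fun x => real_inner_comm _ _)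
    rw [hsym] at h
    linarith
  -- the truncation defect
  have hdef : (∫ x, ⟪δu x, Torus.convect u u x⟫_ℝ) - (∫ x, ⟪P x, Torus.convect u u x⟫_ℝ) =
      ∫ x, ⟪Torus.convect u u x, δu x - P x⟫_ℝ := by
    rw [← integral_sub hi1 hiP]
    refine integral_congr_ae (ae_of_all _ fun x => ?_)
    show ⟪δu x, Torus.convect u u x⟫_ℝ - ⟪P x, Torus.convect u u x⟫_ℝ = ⟪Torus.convect u u x, δu x - P x⟫_ℝ
    rw [inner_sub_right, real_inner_comm (δu x), real_inner_comm (P x)]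
  have hI1 : (∫ x, ⟪δu x, Torus.convect δu u' x⟫_ℝ) = ∫ x, ⟪Torus.convect δu u' x, δu x⟫_ℝ :=
    integral_congr_ae (ae_of_all _ fun x => real_inner_comm _ _)
  rw [hsplit, hcancel, hI1]
  have hz := neg_le_abs (∫ x, ⟪Torus.convect u u x, δu x - P x⟫_ℝ)
  have hj := neg_le_abs (∫ x, ⟪Torus.convect δu u' x, δu x⟫_ℝ)
  linarith

end CauchyPairing

/-! ## Quantitative bounds for the Cauchy pairing -/

section CauchyBounds

variable {S S' : Finset (d → ℤ)}

/-- The transport term: `|∫⟪(δu·∇)u', δu⟫| ≤ #d √B (2π) √W₃(ā) · ∑_{k∈S'} ‖δ k‖²`. [folklore] -/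
theorem abs_transportTerm_le (hS' : ∀ k ∈ S', -k ∈ S') {B : ℝ}
    (hB : ∑ k ∈ S', ((1 + freqNormSq k) ^ 2)⁻¹ ≤ B) {A δ : (d → ℤ) → EuclideanSpace ℂ d}
    (hδ : IsConjSymm δ) :
    |∫ x, ⟪Torus.convect (realTrigPoly S' δ) (realTrigPoly S' A) x, realTrigPoly S' δ x⟫_ℝ| ≤
      Fintype.card d * Real.sqrt B * (2 * Real.pi) *
        Real.sqrt (∑ k ∈ S', (1 + freqNormSq k) ^ 3 * ‖A k‖ ^ 2) * ∑ k ∈ S', ‖δ k‖ ^ 2 := by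
  have hB0 : 0 ≤ B := le_trans (Finset.sum_nonneg fun k _ => inv_nonneg.2 (sq_nonneg _)) hB
  have hπ : 0 ≤ 2 * Real.pi := by positivity
  have hW : ∀ j x, ‖Torus.partialDeriv j (realTrigPoly S' A) x‖ ≤
      Real.sqrt B * ((2 * Real.pi) * Real.sqrt (∑ k ∈ S', (1 + freqNormSq k) ^ 3 * ‖A k‖ ^ 2)) := by
    intro j x
    have h := sq_norm_mixed_le (c := A) hB j j 0 x
    simp only [Function.iterate_zero, id_eq, zero_add, mul_one, show (0 : ℕ) + 1 + 2 = 3 by norm_num] at h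
    have h' := Real.sqrt_le_sqrt h
    rw [Real.sqrt_sq (norm_nonneg _), Real.sqrt_mul hB0, Real.sqrt_mul (pow_nonneg hπ _),
      Real.sqrt_sq hπ] at h'
    exact h'
  have h := abs_integral_inner_convect_le_of_sup_right (isSmooth_realTrigPoly S' δ) (isSmooth_realTrigPoly S' A)
    (isSmooth_realTrigPoly S' δ) hW
  refine h.trans (le_of_eq ?_)
  rw [Finset.sum_const, Finset.card_univ, nsmul_eq_mul, Real.mul_self_sqrt (integral_nonneg fun x => sq_nonneg _),
    integral_norm_sq_realTrigPoly hS' hδ]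
  ring

/-- The truncation-defect term: `|∫⟪(u·∇)u, e⟫| ≤ √B √W₂(b̄) · #d (2π) √W₁(b̄) · ‖e‖_{L²}` for
`u = realTrigPoly S b̄`. [folklore] -/
theorem abs_defectTerm_le (hS : ∀ k ∈ S, -k ∈ S) {B : ℝ} (hB : ∑ k ∈ S, ((1 + freqNormSq k) ^ 2)⁻¹ ≤ B)
    {Bc : (d → ℤ) → EuclideanSpace ℂ d} (hBc : IsConjSymm Bc) {e : UnitAddTorus d → EuclideanSpace ℝ d}
    (he : IsSmooth e) :
    |∫ x, ⟪Torus.convect (realTrigPoly S Bc) (realTrigPoly S Bc) x, e x⟫_ℝ| ≤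
      Real.sqrt B * Real.sqrt (∑ k ∈ S, (1 + freqNormSq k) ^ 2 * ‖Bc k‖ ^ 2) *
        (Fintype.card d * ((2 * Real.pi) * Real.sqrt (∑ k ∈ S, (1 + freqNormSq k) ^ 1 * ‖Bc k‖ ^ 2)) *
          Real.sqrt (∫ x, ‖e x‖ ^ 2)) := by
  have hB0 : 0 ≤ B := le_trans (Finset.sum_nonneg fun k _ => inv_nonneg.2 (sq_nonneg _)) hB
  have hπ : 0 ≤ 2 * Real.pi := by positivity
  have hU : ∀ x, ‖realTrigPoly S Bc x‖ ≤ Real.sqrt B * Real.sqrt (∑ k ∈ S, (1 + freqNormSq k) ^ 2 * ‖Bc k‖ ^ 2) := by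
    intro x
    have h := sq_norm_realTrigPoly_le_of_symbol (c := Bc) (c' := Bc) (M := 1) (r := 0)
      (fun k _ => by rw [one_mul, pow_zero, one_mul]) hB x
    rw [one_mul, zero_add] at h
    have h' := Real.sqrt_le_sqrt h
    rwa [Real.sqrt_sq (norm_nonneg _), Real.sqrt_mul hB0] at h'
  have hus : IsSmooth (realTrigPoly S Bc) := isSmooth_realTrigPoly S Bc
  have h := abs_integral_inner_convect_le_of_sup_left (v := realTrigPoly S Bc) hus he hU
  refine h.trans (mul_le_mul_of_nonneg_left ?_ (by positivity))
  have hj : ∀ j, Real.sqrt (∫ x, ‖Torus.partialDeriv j (realTrigPoly S Bc) x‖ ^ 2) ≤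
      (2 * Real.pi) * Real.sqrt (∑ k ∈ S, (1 + freqNormSq k) ^ 1 * ‖Bc k‖ ^ 2) := by
    intro j
    have h1 := integral_norm_sq_iterate_le hS hBc j 1
    simp only [Function.iterate_one, mul_one] at h1
    have h2 := sqrt_le_sqrt_mul_sqrt (pow_nonneg hπ 2) h1
    rwa [Real.sqrt_sq hπ] at h2
  calc ∑ j, Real.sqrt (∫ x, ‖Torus.partialDeriv j (realTrigPoly S Bc) x‖ ^ 2) * Real.sqrt (∫ x, ‖e x‖ ^ 2)
      ≤ ∑ _j : d, (2 * Real.pi) * Real.sqrt (∑ k ∈ S, (1 + freqNormSq k) ^ 1 * ‖Bc k‖ ^ 2) *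
          Real.sqrt (∫ x, ‖e x‖ ^ 2) :=
        Finset.sum_le_sum fun j _ => mul_le_mul_of_nonneg_right (hj j) (Real.sqrt_nonneg _)
    _ = _ := by rw [Finset.sum_const, Finset.card_univ, nsmul_eq_mul]; ring

omit [DecidableEq d] in
/-- **The truncation defect**: `δu - P_Sδu = realTrigPoly S' (δ - 1_S δ)`, and its `L²` norm only
sees the modes of `S' \ S`, where `δ = ā`: `∫‖δu - P_Sδu‖² = ∑_{k∈S'} [k ∉ S] ‖ā k‖²`. [folklore] -/
theorem integral_norm_sq_defect (hS : ∀ k ∈ S, -k ∈ S) (hS' : ∀ k ∈ S', -k ∈ S') (hSS' : S ⊆ S')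
    {A Bc : (d → ℤ) → EuclideanSpace ℂ d} (hA : IsConjSymm A) (hBc : IsConjSymm Bc)
    (hB0 : ∀ k, k ∉ S → Bc k = 0) :
    ∫ x, ‖realTrigPoly S' (A - Bc) x - realTrigPoly S (A - Bc) x‖ ^ 2 =
      ∑ k ∈ S', if k ∈ S then 0 else ‖A k‖ ^ 2 := by
  classical
  have hδc : IsConjSymm (A - Bc) := hA.sub hBc
  have hfc : IsConjSymm ((A - Bc) - fun k => if k ∈ S then (A - Bc) k else 0) := hδc.sub (hδc.indicator hS)
  have hfun : (fun x => realTrigPoly S' (A - Bc) x - realTrigPoly S (A - Bc) x) =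
      realTrigPoly S' ((A - Bc) - fun k => if k ∈ S then (A - Bc) k else 0) := by
    rw [realTrigPoly_sub S' (A - Bc) (fun k => if k ∈ S then (A - Bc) k else 0),
      realTrigPoly_eq_realTrigPoly_indicator hSS' (A - Bc)]
    rfl
  rw [show (fun x => ‖realTrigPoly S' (A - Bc) x - realTrigPoly S (A - Bc) x‖ ^ 2) =
      fun x => ‖realTrigPoly S' ((A - Bc) - fun k => if k ∈ S then (A - Bc) k else 0) x‖ ^ 2 by
    funext x; rw [← hfun]]
  rw [integral_norm_sq_realTrigPoly hS' hfc]
  refine Finset.sum_congr rfl fun k _ => ?_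
  by_cases hk : k ∈ S
  · simp [hk]
  · simp only [Pi.sub_apply, if_neg hk, sub_zero, hB0 k hk]

/-- **Tail bound on frequency balls**: for `S = freqBall n ⊆ S'`,
`∑_{k∈S'} [k ∉ freqBall n] ‖A k‖² ≤ (1 + n²)^{-s} ∑_{k∈S'} (1+|k|²)ˢ ‖A k‖²`. [folklore] -/
theorem tail_le (n : ℕ) (A : (d → ℤ) → EuclideanSpace ℂ d) (s : ℕ) :
    ∑ k ∈ S', (if k ∈ freqBall n then 0 else ‖A k‖ ^ 2) ≤
      ((1 + (n : ℝ) ^ 2) ^ s)⁻¹ * ∑ k ∈ S', (1 + freqNormSq k) ^ s * ‖A k‖ ^ 2 := by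
  rw [Finset.mul_sum]
  refine Finset.sum_le_sum fun k _ => ?_
  have hn : (0 : ℝ) < (1 + (n : ℝ) ^ 2) ^ s := by positivity
  by_cases hk : k ∈ freqBall n
  · rw [if_pos hk]
    exact mul_nonneg (inv_nonneg.2 hn.le) (mul_nonneg (pow_nonneg (by linarith [freqNormSq_nonneg k]) _) (sq_nonneg _))
  · rw [if_neg hk]
    have hlt := not_mem_freqBall.1 hk
    have hle : (1 + (n : ℝ) ^ 2) ^ s ≤ (1 + freqNormSq k) ^ s :=
      pow_le_pow_left₀ (by positivity) (by linarith) s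
    calc ‖A k‖ ^ 2 = ((1 + (n : ℝ) ^ 2) ^ s)⁻¹ * ((1 + (n : ℝ) ^ 2) ^ s * ‖A k‖ ^ 2) := by
          rw [← mul_assoc, inv_mul_cancel₀ hn.ne', one_mul]
      _ ≤ ((1 + (n : ℝ) ^ 2) ^ s)⁻¹ * ((1 + freqNormSq k) ^ s * ‖A k‖ ^ 2) :=
          mul_le_mul_of_nonneg_left (mul_le_mul_of_nonneg_right hle (sq_nonneg _)) (inv_nonneg.2 hn.le)

end CauchyBounds

/-! ## The Cauchy estimate along two Galerkin solutions -/

section Cauchy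

variable {S S' : Finset (d → ℤ)}

omit [DecidableEq d] in
/-- Extension by zero from `S` followed by restriction to `S'`, as a continuous linear map of the
finite-dimensional coefficient spaces. [folklore] -/
theorem exists_extendCLM (S S' : Finset (d → ℤ)) :
    ∃ L : (↥S → EuclideanSpace ℂ d) →L[ℝ] (↥S' → EuclideanSpace ℂ d),
      ∀ c k, L c k = coeffExt S c (k : d → ℤ) := by
  let Lₗ : (↥S → EuclideanSpace ℂ d) →ₗ[ℝ] (↥S' → EuclideanSpace ℂ d) :=
    { toFun := fun c k => coeffExt S c (k : d → ℤ)
      map_add' := fun c c' => by funext k; simp [coeffExt_add]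
      map_smul' := fun r c => by funext k; simp [coeffExt_smul] }
  exact ⟨LinearMap.toContinuousLinearMap Lₗ, fun c k => rfl⟩

/-- **The Cauchy pairing at a fixed time, quantitative form.** For `S ⊆ S'` symmetric, states
`a` (on `S'`) and `b` (on `S`) in the Galerkin phase spaces, `ā = coeffExt S' a`,
`b̄ = coeffExt S b`, and `∑_{k∈S'} ((1+|k|²)²)⁻¹ ≤ B`:
`∑_k 2Re⟪a k - b̄ k, V_{S'}(a)_k - 1_S V_S(b)_k⟫
  ≤ 2 #d √B (2π) √W₃(ā) · ∑_k ‖a k - b̄ k‖² + 2 √B √W₂(b̄) · #d (2π) √W₁(b̄) · (∑_{k∈S'∖S} ‖ā k‖²)^{1/2}`.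
[cite: MajdaBertozziCUP2002, Thm. 3.4 proof, (3.61)–(3.62)] -/
theorem cauchyPairing_le (hS : ∀ k ∈ S, -k ∈ S) (hS' : ∀ k ∈ S', -k ∈ S') (hSS' : S ⊆ S')
    {ν : ℝ} (hν : 0 ≤ ν) {σ : (d → ℤ) → ℝ} (hσ : ∀ k, 0 ≤ σ k) {B : ℝ}
    (hB : ∑ k ∈ S', ((1 + freqNormSq k) ^ 2)⁻¹ ≤ B) {a : ↥S' → EuclideanSpace ℂ d}
    (ha : a ∈ galerkinSubspace S') {b : ↥S → EuclideanSpace ℂ d} (hb : b ∈ galerkinSubspace S) :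
    ∑ k : ↥S', 2 * (inner ℂ (a k - coeffExt S b (k : d → ℤ))
        (galerkinRHS S' ν (fun k : ↥S' => -((((σ (k : d → ℤ)) : ℝ) : ℂ) • a k)) a k -
          coeffExt S (galerkinRHS S ν (fun k : ↥S => -((((σ (k : d → ℤ)) : ℝ) : ℂ) • b k)) b) (k : d → ℤ))).re ≤
      2 * (Fintype.card d * Real.sqrt B * (2 * Real.pi) *
        Real.sqrt (∑ k ∈ S', (1 + freqNormSq k) ^ 3 * ‖coeffExt S' a k‖ ^ 2)) *
          ∑ k : ↥S', ‖a k - coeffExt S b (k : d → ℤ)‖ ^ 2 +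
      2 * (Real.sqrt B * Real.sqrt (∑ k ∈ S, (1 + freqNormSq k) ^ 2 * ‖coeffExt S b k‖ ^ 2) *
        (Fintype.card d * ((2 * Real.pi) * Real.sqrt (∑ k ∈ S, (1 + freqNormSq k) ^ 1 * ‖coeffExt S b k‖ ^ 2)) *
          Real.sqrt (∑ k ∈ S', if k ∈ S then 0 else ‖coeffExt S' a k‖ ^ 2))) := by
  have hB0 : 0 ≤ B := le_trans (Finset.sum_nonneg fun k _ => inv_nonneg.2 (sq_nonneg _)) hB
  have hBS : ∑ k ∈ S, ((1 + freqNormSq k) ^ 2)⁻¹ ≤ B :=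
    le_trans (Finset.sum_le_sum_of_subset_of_nonneg hSS' fun k _ _ => inv_nonneg.2 (sq_nonneg _)) hB
  have hAc : IsConjSymm (coeffExt S' a) := ha.1.isConjSymm_coeffExt hS'
  have hBcc : IsConjSymm (coeffExt S b) := hb.1.isConjSymm_coeffExt hS
  -- the pairing as a sum over `S'`
  have hsum : ∑ k : ↥S', 2 * (inner ℂ (a k - coeffExt S b (k : d → ℤ))
      (galerkinRHS S' ν (fun k : ↥S' => -((((σ (k : d → ℤ)) : ℝ) : ℂ) • a k)) a k -
        coeffExt S (galerkinRHS S ν (fun k : ↥S => -((((σ (k : d → ℤ)) : ℝ) : ℂ) • b k)) b) (k : d → ℤ))).re =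
      2 * ∑ k ∈ S', (inner ℂ (coeffExt S' a k - coeffExt S b k)
        (galerkinField ν S' (fun k => -((((σ k) : ℝ) : ℂ) • coeffExt S' a k)) (coeffExt S' a) k -
          coeffExt S (galerkinRHS S ν (fun k : ↥S => -((((σ (k : d → ℤ)) : ℝ) : ℂ) • b k)) b) k)).re := by
    rw [Finset.mul_sum]
    symm
    rw [sum_coeffExt (fun k v => 2 * (inner ℂ (v - coeffExt S b k)
      (galerkinField ν S' (fun k => -((((σ k) : ℝ) : ℂ) • coeffExt S' a k)) (coeffExt S' a) k -
        coeffExt S (galerkinRHS S ν (fun k : ↥S => -((((σ (k : d → ℤ)) : ℝ) : ℂ) • b k)) b) k)).re) a]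
    refine Finset.sum_congr rfl fun k _ => ?_
    rw [galerkinRHS_apply, coeffExt_dampForce]
  have hE : ∑ k : ↥S', ‖a k - coeffExt S b (k : d → ℤ)‖ ^ 2 =
      ∑ k ∈ S', ‖(coeffExt S' a - coeffExt S b) k‖ ^ 2 := by
    rw [← sum_coeffExt (fun k v => ‖v - coeffExt S b k‖ ^ 2) a]
    rfl
  have h1 := sum_re_inner_fieldDiff_le hSS' hν hσ ha hb
  have h2 := convectionPairing_diff_le hS hS' hSS' ha hb
  have h3 := abs_transportTerm_le (A := coeffExt S' a) (δ := coeffExt S' a - coeffExt S b) hS' hB (hAc.sub hBcc)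
  have hes : IsSmooth (fun x => realTrigPoly S' (coeffExt S' a - coeffExt S b) x -
      realTrigPoly S (coeffExt S' a - coeffExt S b) x) :=
    (isSmooth_realTrigPoly S' _).sub (isSmooth_realTrigPoly S _)
  have h4 := abs_defectTerm_le hS hBS hBcc hes
  have h5 := integral_norm_sq_defect hS hS' hSS' hAc hBcc (fun k hk => coeffExt_of_not_mem b hk)
  rw [hsum, hE, ← h5]
  have h12 := h1.trans h2
  linarith [h12, h3, h4]

/-- **The Cauchy estimate for the Galerkin approximations** (Majda–Bertozzi 2002, proof of
Thm. 3.4, (3.61)–(3.64): "the family `(v^ε)` forms a Cauchy sequence in `C([0,T]; L²)`"; here for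
the Fourier–Galerkin truncations to `freqBall n ⊆ freqBall n'` of the damped system on `T^d`,
uniformly in `ν ≥ 0`, `σ ≥ 0`). Let `β` (on `freqBall n`) and `β'` (on `freqBall n'`) solve the
damped Galerkin systems on `[0, T]` in the Galerkin phase spaces, with `W₃(β̄'(t)) ≤ R`,
`W₂(β̄(t)) ≤ R` and `W_s(β̄'(t)) ≤ R_s` on `[0,T]`. Then
`E(t) = ∑_k ‖β' t k - β̄ t k‖² ≤ gronwallBound E(0) K ε t` with `K = 2 #d √B (2π) √R` and
`ε = 2 √B √R · #d (2π) √R · √((1+n²)^{-s} R_s)` — i.e. `E(t) ≤ E(0)e^{Kt} + (ε/K)(e^{Kt} - 1)`, where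
`E(0), ε = O((1+n²)^{-s/2})`. [cite: MajdaBertozziCUP2002, Thm. 3.4 proof, (3.61)–(3.64)] -/
theorem galerkin_cauchy_estimate {n n' : ℕ} (hnn' : n ≤ n') {ν : ℝ} (hν : 0 ≤ ν) {σ : (d → ℤ) → ℝ}
    (hσ : ∀ k, 0 ≤ σ k) {B : ℝ} (hB : ∑ k ∈ freqBall (d := d) n', ((1 + freqNormSq k) ^ 2)⁻¹ ≤ B) {T : ℝ}
    {β : ℝ → ↥(freqBall (d := d) n) → EuclideanSpace ℂ d}
    (hβ : ∀ t ∈ Icc 0 T, HasDerivWithinAt β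
      (galerkinRHS (freqBall n) ν (fun k : ↥(freqBall (d := d) n) => -((((σ (k : d → ℤ)) : ℝ) : ℂ) • β t k)) (β t))
      (Icc 0 T) t)
    (hmem : ∀ t ∈ Icc 0 T, β t ∈ galerkinSubspace (freqBall n))
    {β' : ℝ → ↥(freqBall (d := d) n') → EuclideanSpace ℂ d}
    (hβ' : ∀ t ∈ Icc 0 T, HasDerivWithinAt β'
      (galerkinRHS (freqBall n') ν (fun k : ↥(freqBall (d := d) n') => -((((σ (k : d → ℤ)) : ℝ) : ℂ) • β' t k)) (β' t))
      (Icc 0 T) t)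
    (hmem' : ∀ t ∈ Icc 0 T, β' t ∈ galerkinSubspace (freqBall n'))
    {R : ℝ}
    (hR3 : ∀ t ∈ Icc 0 T, ∑ k ∈ freqBall n', (1 + freqNormSq k) ^ 3 * ‖coeffExt (freqBall n') (β' t) k‖ ^ 2 ≤ R)
    (hR2 : ∀ t ∈ Icc 0 T, ∑ k ∈ freqBall n, (1 + freqNormSq k) ^ 2 * ‖coeffExt (freqBall n) (β t) k‖ ^ 2 ≤ R)
    {s : ℕ} {Rs : ℝ}
    (hRs : ∀ t ∈ Icc 0 T, ∑ k ∈ freqBall n', (1 + freqNormSq k) ^ s * ‖coeffExt (freqBall n') (β' t) k‖ ^ 2 ≤ Rs) :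
    ∀ t ∈ Icc 0 T, ∑ k : ↥(freqBall (d := d) n'), ‖β' t k - coeffExt (freqBall n) (β t) (k : d → ℤ)‖ ^ 2 ≤
      gronwallBound (∑ k : ↥(freqBall (d := d) n'), ‖β' 0 k - coeffExt (freqBall n) (β 0) (k : d → ℤ)‖ ^ 2)
        (2 * (Fintype.card d * Real.sqrt B * (2 * Real.pi) * Real.sqrt R))
        (2 * (Real.sqrt B * Real.sqrt R * (Fintype.card d * ((2 * Real.pi) * Real.sqrt R) *
          Real.sqrt (((1 + (n : ℝ) ^ 2) ^ s)⁻¹ * Rs)))) t := by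
  have hS : ∀ k ∈ freqBall (d := d) n, -k ∈ freqBall (d := d) n := neg_mem_freqBall_of_mem
  have hS' : ∀ k ∈ freqBall (d := d) n', -k ∈ freqBall (d := d) n' := neg_mem_freqBall_of_mem
  have hSS' : freqBall (d := d) n ⊆ freqBall n' := freqBall_mono hnn'
  have hB0 : 0 ≤ B := le_trans (Finset.sum_nonneg fun k _ => inv_nonneg.2 (sq_nonneg _)) hB
  obtain ⟨L, hL⟩ := exists_extendCLM (d := d) (freqBall n) (freqBall n')
  -- the difference curve, its energy and the derivative of the energy
  have hΔderiv : ∀ t ∈ Icc 0 T, HasDerivWithinAt (fun τ => β' τ - L (β τ))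
      (galerkinRHS (freqBall n') ν (fun k : ↥(freqBall (d := d) n') => -((((σ (k : d → ℤ)) : ℝ) : ℂ) • β' t k)) (β' t) -
        L (galerkinRHS (freqBall n) ν (fun k : ↥(freqBall (d := d) n) => -((((σ (k : d → ℤ)) : ℝ) : ℂ) • β t k)) (β t)))
      (Icc 0 T) t := fun t ht =>
    (hβ' t ht).sub (L.hasFDerivAt.comp_hasDerivWithinAt t (hβ t ht))
  set f : ℝ → ℝ := fun t => ∑ k : ↥(freqBall (d := d) n'), ‖β' t k - coeffExt (freqBall n) (β t) (k : d → ℤ)‖ ^ 2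
    with hf
  set f' : ℝ → ℝ := fun t => ∑ k : ↥(freqBall (d := d) n'), 2 * (inner ℂ (β' t k - coeffExt (freqBall n) (β t) (k : d → ℤ))
    (galerkinRHS (freqBall n') ν (fun k : ↥(freqBall (d := d) n') => -((((σ (k : d → ℤ)) : ℝ) : ℂ) • β' t k)) (β' t) k -
      coeffExt (freqBall n) (galerkinRHS (freqBall n) ν
        (fun k : ↥(freqBall (d := d) n) => -((((σ (k : d → ℤ)) : ℝ) : ℂ) • β t k)) (β t)) (k : d → ℤ))).re
    with hf'
  have hfderiv : ∀ t ∈ Icc 0 T, HasDerivWithinAt f (f' t) (Icc 0 T) t := by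
    intro t ht
    have h := hasDerivWithinAt_sum_norm_sq (hΔderiv t ht)
    simp only [Pi.sub_apply, hL] at h
    exact h
  have hcont : ContinuousOn f (Icc 0 T) := fun t ht => (hfderiv t ht).continuousWithinAt
  -- the differential inequality `f' ≤ K f + ε`
  set K : ℝ := 2 * (Fintype.card d * Real.sqrt B * (2 * Real.pi) * Real.sqrt R) with hK
  set ε : ℝ := 2 * (Real.sqrt B * Real.sqrt R * (Fintype.card d * ((2 * Real.pi) * Real.sqrt R) *
    Real.sqrt (((1 + (n : ℝ) ^ 2) ^ s)⁻¹ * Rs))) with hε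
  have hbound : ∀ t ∈ Ico 0 T, f' t ≤ K * f t + ε := by
    intro t ht
    have htc : t ∈ Icc 0 T := Ico_subset_Icc_self ht
    have hmain := cauchyPairing_le hS hS' hSS' hν hσ hB (hmem' t htc) (hmem t htc)
    have hE0 : 0 ≤ f t := Finset.sum_nonneg fun k _ => sq_nonneg _
    -- bound the coefficients by `R`, `R_s`
    have hsq3 : Real.sqrt (∑ k ∈ freqBall n', (1 + freqNormSq k) ^ 3 * ‖coeffExt (freqBall n') (β' t) k‖ ^ 2) ≤
        Real.sqrt R := Real.sqrt_le_sqrt (hR3 t htc)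
    have hsq2 : Real.sqrt (∑ k ∈ freqBall n, (1 + freqNormSq k) ^ 2 * ‖coeffExt (freqBall n) (β t) k‖ ^ 2) ≤
        Real.sqrt R := Real.sqrt_le_sqrt (hR2 t htc)
    have hsq1 : Real.sqrt (∑ k ∈ freqBall n, (1 + freqNormSq k) ^ 1 * ‖coeffExt (freqBall n) (β t) k‖ ^ 2) ≤
        Real.sqrt R :=
      Real.sqrt_le_sqrt ((sum_weight_pow_mul_norm_sq_mono (freqBall n) _ (by norm_num : 1 ≤ 2)).trans (hR2 t htc))
    have htail : Real.sqrt (∑ k ∈ freqBall n', if k ∈ freqBall n then 0 else ‖coeffExt (freqBall n') (β' t) k‖ ^ 2) ≤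
        Real.sqrt (((1 + (n : ℝ) ^ 2) ^ s)⁻¹ * Rs) := by
      refine Real.sqrt_le_sqrt ((tail_le (S' := freqBall n') n _ s).trans ?_)
      exact mul_le_mul_of_nonneg_left (hRs t htc) (inv_nonneg.2 (by positivity))
    have hc1 : 2 * (Fintype.card d * Real.sqrt B * (2 * Real.pi) *
        Real.sqrt (∑ k ∈ freqBall n', (1 + freqNormSq k) ^ 3 * ‖coeffExt (freqBall n') (β' t) k‖ ^ 2)) * f t ≤
        K * f t := by
      rw [hK]
      exact mul_le_mul_of_nonneg_right (mul_le_mul_of_nonneg_left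
        (mul_le_mul_of_nonneg_left hsq3 (by positivity)) (by norm_num)) hE0
    have hc2 : 2 * (Real.sqrt B * Real.sqrt (∑ k ∈ freqBall n, (1 + freqNormSq k) ^ 2 * ‖coeffExt (freqBall n) (β t) k‖ ^ 2) *
        (Fintype.card d * ((2 * Real.pi) * Real.sqrt (∑ k ∈ freqBall n, (1 + freqNormSq k) ^ 1 *
          ‖coeffExt (freqBall n) (β t) k‖ ^ 2)) *
          Real.sqrt (∑ k ∈ freqBall n', if k ∈ freqBall n then 0 else ‖coeffExt (freqBall n') (β' t) k‖ ^ 2))) ≤ ε := by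
      rw [hε]
      gcongr
    exact hmain.trans (add_le_add hc1 hc2)
  have hgron := le_gronwallBound_of_liminf_deriv_right_le (f := f) (f' := f') (δ := f 0) (K := K) (ε := ε)
    (a := 0) (b := T) hcont
    (fun x hx r hr => (hasDerivWithinAt_Ici_of_Icc hx (hfderiv x (Ico_subset_Icc_self hx))).liminf_right_slope_le hr)
    le_rfl hbound
  intro t ht
  have h := hgron t ht
  rwa [sub_zero] at h

end Cauchy
end GalerkinSmooth

end Literature.Analysis.FluidPDE
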